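import Summits.HodgeConjecture.HodgeConjecture.Theorems.F0P2oYCoinvariantsChartCM        -- ★ p835408 F0P2-p01 (g8): the (E1-CM) chart, conjuncts (v)(vi)
import Summits.HodgeConjecture.HodgeConjecture.Theorems.F0P2oN3OfLineJacquetChart         -- ★ F0P2-p06 (g4): `exists_coinvariantsEquiv_of_chart` (first iso theorem)
import Literature.RepresentationTheory.HeisenbergGroup.SchrodingerFibreSurjective          -- (SJ-gen) (this seat): `surjective_of_fibre_formula`
import HarnessLib

/-!
# Crux `H413`, programme P2, N3 road (a) — (SJ-CM) «THE JACQUET CHART ISO»: `r_N(ω_v ∘ ch) ≃ 𝒮(L⁺_v)`, `[f] ↦ φ₀ (Ψ f)`, from the chart's fibre clauses (v)(vi)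

Cell hodgecm-mathlib (D-0151), FLOOR 0, crux item H413 = stmt-HodgeConjecture-24833, programme P2; N3 road (a) of the K1∕N3 lead B-p18 (g29) (LEAD WORDS
2026-08-31T23:56:16Z (3), brick (SJ) = (SJ-gen) ★ `SchrodingerFibreSurjective` + this file); seat F0P2-p02 (g7).  THEOREMS ONLY; no `Cruxes/…/Lines` import;
kernel lane `--supports stmt-HodgeConjecture-24833 --as helper`.  HC_CM is proved only modulo the 2 remaining named inputs (hLiu418, h413) — behind them the booked
printed statements + the MOD package — until rung 0 closes; this file discharges nothing booked: it is the `πbar` input of the lead's (JA) assembly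
`Theorems/F0P2oN3LineJacquetHolds.lean :: lineJacquet_holds`.

For ANY frame data `(e₁, dV, T)` with form congruence `(a, h)`, any splitting package `𝓢`, and any pair `(Ψ, φ₀)` satisfying the two fibre clauses of
★ p835408 `F0P2oYCoinvariantsChartCM.exists_chart_of_nonsplit` — (v) `(φ₀ f)(u₀) = f (Sum.elim 0 u₀)` and (vi) «the `N`-coboundaries of `Ω = ω_v ∘ ch` are
`Ψ⁻¹(ker φ₀)`», VERBATIM — the Jacquet module of `Ω` along the Borel `B = TN` of `U(Φ₃)(L⁺_v)` is `𝒮(Fin 1 → L⁺_v)` through `[f] ↦ φ₀ (Ψ f)`: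
`φ₀` is onto (★ (SJ-gen) `surjective_of_fibre_formula`, preimage `1_{𝒪²} ⊠ g`), `Ψ` is a linear equivalence, `ker (φ₀ ∘ Ψ) = Ψ⁻¹(ker φ₀)` (`LinearMap.ker_comp`)
`=` the coboundary submodule by (vi), and the first isomorphism theorem (★ `F0P2oN3OfLineJacquetChart.exists_coinvariantsEquiv_of_chart`).
[GelbartRogawski1991 §3.2 p. 457 «`r_N(ω³) ≅ ℱ`, `Φ ↦ Φ(0)`»; Kudla1986 Thm. 2.8; BernsteinZelevinsky1977 §1.8.]

## References
* [GelbartRogawski1991] S. Gelbart, J. Rogawski, Invent. Math. 105 (1991): §3.2 (3.2.1)–(3.2.3) p. 457.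
* [Kudla1986] S. Kudla, Invent. Math. 83 (1986): Thm. 2.8.
* [BernsteinZelevinsky1977] I. N. Bernstein, A. V. Zelevinsky, Ann. sci. ÉNS 10 (1977): §1.8 (Jacquet functor, exactness).
-/

set_option autoImplicit false
-- the mandated namespace repeats the single-problem summit's segment (`HodgeConjecture.HodgeConjecture`)
set_option linter.dupNamespace false

noncomputable section

open scoped MatrixGroups Kronecker
open _root_.Matrix NumberField IsDedekindDomain
open Literature.NumberTheory.Automorphic Literature.NumberTheory.Automorphic.UnitaryGroup
open Literature.NumberTheory.Automorphic.UnitaryGroup.QuadraticCoordinates Literature.NumberTheory.Automorphic.UnitaryGroup.IsQuadraticCoordinates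
open Literature.NumberTheory.Automorphic.Liu2021 Literature.NumberTheory.Automorphic.Liu2021.Def411WeilCarriers
open Literature.NumberTheory.GelbartRogawski1991 Literature.NumberTheory.GelbartRogawski1991.UnitaryDualPair
open Literature.NumberTheory.GelbartRogawski1991.UnitaryDualPair.LocalSplitting
open Literature.RepresentationTheory Literature.RepresentationTheory.HeisenbergGroup
open Summit.HodgeConjecture.HodgeConjecture.Cruxes.H413.F0P2oN3OfLineJacquetChart

namespace Summit.HodgeConjecture.HodgeConjecture.Cruxes.H413.F0P2oJacquetChartOfFibre

variable (L : Type) [Field L] [NumberField L] [IsCMField L]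

set_option synthInstance.maxHeartbeats 400000 in
set_option maxHeartbeats 16000000 in
/-- **THE JACQUET CHART ISO `r_N(ω_v ∘ ch) ≃ 𝒮(Fin 1 → L⁺_v)`, `[f] ↦ φ₀ (Ψ f)`**, from the fibre clauses (v)(vi) of ★ p835408 `exists_chart_of_nonsplit` taken as
hypotheses VERBATIM (any frame `(e₁, dV, T, a, h)`, any splitting package `𝓢`, any `(Ψ, φ₀)`): `φ₀ ∘ Ψ` is onto (★ (SJ-gen) + `Ψ` an equivalence) with kernel the
`N`-coboundary submodule ((vi) + `LinearMap.ker_comp`), so the first isomorphism theorem (★ `exists_coinvariantsEquiv_of_chart`) gives `πbar`.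
[cite: GelbartRogawski1991, §3.2 (3.2.1)–(3.2.3) p. 457] [cite: Kudla1986, Thm. 2.8] [cite: BernsteinZelevinsky1977, §1.8] -/
theorem exists_jacquetChart_of_fibre {n' : ℕ} (e₁ : Fin 3 × Fin 1 ≃ Fin n') (dV : Fin 3 → L)
    (hdV : ∀ i, IsCMField.complexConj L (dV i) = dV i) (ε : (↥(maximalRealSubfield L))ˣ)
    (v : HeightOneSpectrum (𝓞 ↥(maximalRealSubfield L)))
    (𝓢 : FinLocalSplittings (↥(maximalRealSubfield L)) L (IsCMField.complexConj L) n' (complexConj_imagUnit L) (imagUnit_ne_zero L)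
      (imagUnit_mul_self L) (gram (↥(maximalRealSubfield L)) e₁ (realDiagonal L dV hdV) (TW (↥(maximalRealSubfield L)) ε))
      (isSymm_gram (↥(maximalRealSubfield L)) e₁ (realDiagonal_isSymm L dV hdV) (isSymm_TW (↥(maximalRealSubfield L)) ε))
      (J := Matrix.reindex e₁ e₁ (Matrix.diagonal dV ⊗ₖ JW (↥(maximalRealSubfield L)) L ε))
      (reindex_kronecker_eq_gram_map (↥(maximalRealSubfield L)) L e₁ (realDiagonal_map L dV hdV).symm (JW_eq (↥(maximalRealSubfield L)) L ε)))
    (T : GL (Fin 3) (UnitaryGroup.LocalRing L v)) {a : UnitaryGroup.LocalRing L v} (ha : IsUnit a)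
    (h : formCongr (conjLocal L (IsCMField.complexConj L) v) T ((Matrix.diagonal dV).map (algebraMap L (UnitaryGroup.LocalRing L v))) =
      a • (Matrix.of fun i j : Fin 3 => if i.val + j.val + 1 = 3 then (1 : L) else 0).map (algebraMap L (UnitaryGroup.LocalRing L v)))
    (Ψ : SchwartzBruhat (Fin n' → (v.adicCompletion ↥(maximalRealSubfield L))) ≃ₗ[ℂ] SchwartzBruhat ((Fin 2 ⊕ Fin 1) → (v.adicCompletion ↥(maximalRealSubfield L))))
    (φ₀ : SchwartzBruhat ((Fin 2 ⊕ Fin 1) → (v.adicCompletion ↥(maximalRealSubfield L))) →ₗ[ℂ] SchwartzBruhat (Fin 1 → (v.adicCompletion ↥(maximalRealSubfield L))))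
    (hv5 : ∀ (f : SchwartzBruhat ((Fin 2 ⊕ Fin 1) → (v.adicCompletion ↥(maximalRealSubfield L)))) (u₀ : Fin 1 → (v.adicCompletion ↥(maximalRealSubfield L))),
        (φ₀ f : (Fin 1 → (v.adicCompletion ↥(maximalRealSubfield L))) → ℂ) u₀ = (f : ((Fin 2 ⊕ Fin 1) → (v.adicCompletion ↥(maximalRealSubfield L))) → ℂ) (Sum.elim 0 u₀))
    (hvi : Representation.Coinvariants.ker
        ((((MpPsi.toRep (localSchrodinger (↥(maximalRealSubfield L)) n'
          (gram (↥(maximalRealSubfield L)) e₁ (realDiagonal L dV hdV) (TW (↥(maximalRealSubfield L)) ε)) v)).comp (𝓢.s v)).comp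
        ((localLineInl L (IsCMField.complexConj L) 3 e₁ (Matrix.diagonal dV) (JW (↥(maximalRealSubfield L)) L ε) v).comp
          ((localPiEquiv L (IsCMField.complexConj L) 3 (Matrix.diagonal dV) v).symm.toMonoidHom.comp
            (cmDatumLocalCongr L v T ha h).toMonoidHom))).comp (cmBorelTriple L 3 v).N.subtype) =
        (LinearMap.ker φ₀).comap (Ψ : SchwartzBruhat (Fin n' → (v.adicCompletion ↥(maximalRealSubfield L))) →ₗ[ℂ] SchwartzBruhat ((Fin 2 ⊕ Fin 1) → (v.adicCompletion ↥(maximalRealSubfield L))))) :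
    ∃ πbar : ((cmBorelTriple L 3 v).restrict
        (((MpPsi.toRep (localSchrodinger (↥(maximalRealSubfield L)) n'
          (gram (↥(maximalRealSubfield L)) e₁ (realDiagonal L dV hdV) (TW (↥(maximalRealSubfield L)) ε)) v)).comp (𝓢.s v)).comp
        ((localLineInl L (IsCMField.complexConj L) 3 e₁ (Matrix.diagonal dV) (JW (↥(maximalRealSubfield L)) L ε) v).comp
          ((localPiEquiv L (IsCMField.complexConj L) 3 (Matrix.diagonal dV) v).symm.toMonoidHom.comp
            (cmDatumLocalCongr L v T ha h).toMonoidHom)))).Coinvariants ≃ₗ[ℂ]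
        SchwartzBruhat (Fin 1 → (v.adicCompletion ↥(maximalRealSubfield L))),
      ∀ f : SchwartzBruhat (Fin n' → (v.adicCompletion ↥(maximalRealSubfield L))),
        πbar (Representation.Coinvariants.mk _ f) = φ₀ (Ψ f) := by
  -- `φ₀` is onto by the fibre formula (SJ-gen), hence so is `φ₀ ∘ Ψ`
  have hφ₀ : Function.Surjective φ₀ := surjective_of_fibre_formula (v.adicCompletion ↥(maximalRealSubfield L)) φ₀ hv5
  have hπ : Function.Surjective (φ₀ ∘ₗ (Ψ : SchwartzBruhat (Fin n' → (v.adicCompletion ↥(maximalRealSubfield L))) →ₗ[ℂ]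
      SchwartzBruhat ((Fin 2 ⊕ Fin 1) → (v.adicCompletion ↥(maximalRealSubfield L))))) :=
    hφ₀.comp Ψ.surjective
  -- its kernel is the `N`-coboundary submodule by (vi)
  have hker : LinearMap.ker (φ₀ ∘ₗ (Ψ : SchwartzBruhat (Fin n' → (v.adicCompletion ↥(maximalRealSubfield L))) →ₗ[ℂ]
      SchwartzBruhat ((Fin 2 ⊕ Fin 1) → (v.adicCompletion ↥(maximalRealSubfield L))))) =
      Representation.Coinvariants.ker
        ((((MpPsi.toRep (localSchrodinger (↥(maximalRealSubfield L)) n'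
          (gram (↥(maximalRealSubfield L)) e₁ (realDiagonal L dV hdV) (TW (↥(maximalRealSubfield L)) ε)) v)).comp (𝓢.s v)).comp
        ((localLineInl L (IsCMField.complexConj L) 3 e₁ (Matrix.diagonal dV) (JW (↥(maximalRealSubfield L)) L ε) v).comp
          ((localPiEquiv L (IsCMField.complexConj L) 3 (Matrix.diagonal dV) v).symm.toMonoidHom.comp
            (cmDatumLocalCongr L v T ha h).toMonoidHom))).comp (cmBorelTriple L 3 v).N.subtype) := by
    rw [LinearMap.ker_comp, hvi]
  obtain ⟨e, he⟩ := exists_coinvariantsEquiv_of_chart _ (cmBorelTriple L 3 v) _ hπ hker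
  exact ⟨e, fun f => he f⟩

end Summit.HodgeConjecture.HodgeConjecture.Cruxes.H413.F0P2oJacquetChartOfFibre

end
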